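import Literature.MathematicalPhysics.QuantumLattice.SpinChains
import Literature.MathematicalPhysics.QuantumLattice.HeisenbergModelGlobalRotationProofs
import HarnessLib

/-!
# Discharges for `SpinChains` (hubbard.S21): on-site Casimir, `SU(2)` invariance of the ring

Trunk T-QLATTICE. Sibling proof file of
`Literature/MathematicalPhysics/QuantumLattice/SpinChains.lean` (`section SpinSystem` there); it
discharges two named facts (`def … : Prop`, D-0014) of that file and changes no statement,
introduces no definition and no named fact:

* `sum_siteSpin_mul_siteSpin_holds : sum_siteSpin_mul_siteSpin` — the on-site Casimir identity
  `Σ_α (S^α_x)² = S(S+1) 𝟙`, `S = n/2` (Tasaki (2020) §2.1, eq. (2.1.2); §2.2, eq. (2.2.7)):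
  `a ↦ onSite x a` is an algebra homomorphism (`onSite_mul`, `onSite_sum`, `onSite_smul'`,
  `onSite_one'` of `ProductOperators` / `HeisenbergModelGlobalRotationProofs`), so the left-hand
  side is `onSite x (𝐒²)` and `𝐒² = S(S+1)𝟙` is `spinCasimir_eq_holds` (`SpinOperatorsProofs`);
* `commute_heisenbergRing_totalSpin_holds : commute_heisenbergRing_totalSpin` — the periodic
  Heisenberg ring `Σ_{i ∈ ℤ/Lℤ} 𝐒_i · 𝐒_{i+1}` commutes with every component of the total spin
  (Tasaki (2020) §2.5, eq. (2.5.2)): each exchange operator `𝐒_x · 𝐒_y` does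
  (`commute_spinDot_totalSpin` of `HeisenbergModelGlobalRotationProofs`, valid for all sites
  `x, y`, so no hypothesis on `L` is needed), and commutants are closed under sums.

## Sources

H. Tasaki, *Physics and Mathematics of Quantum Many-Body Systems* (Springer, 2020), §2.1
eq. (2.1.2), §2.2 eqs. (2.2.7), (2.2.11), §2.5 eq. (2.5.2). [Tasaki2020]
-/

noncomputable section

open Matrix Complex

namespace Literature.MathematicalPhysics.QuantumLattice

section QLattice

variable {Λ : Type*} [Fintype Λ] [DecidableEq Λ]

/-- `Σ_α S^α_x S^α_x = onSite x (𝐒²)`: the on-site Casimir is the single-site Casimir placed at `x`.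
Tasaki (2020) §2.2, eq. (2.2.7). [cite: Tasaki2020, §2.2 eq. (2.2.7)] -/
theorem sum_siteSpin_mul_siteSpin_eq_onSite_spinCasimir (n : ℕ) (x : Λ) :
    ∑ α : Fin 3, (siteSpin n x α : Op Λ (n + 1)) * siteSpin n x α = onSite x (spinCasimir n) := by
  simp only [siteSpin, onSite_mul, spinCasimir, onSite_sum]

/-- **Discharge of `sum_siteSpin_mul_siteSpin`** (on-site Casimir, hubbard.S21):
`Σ_α (S^α_x)² = S(S+1) 𝟙` with `S = n/2`, for every site `x` of every finite `Λ`.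
Tasaki (2020) §2.1, eq. (2.1.2); §2.2, eq. (2.2.7). [cite: Tasaki2020, §2.1 eq. (2.1.2)] -/
theorem sum_siteSpin_mul_siteSpin_holds : sum_siteSpin_mul_siteSpin (Λ := Λ) := by
  intro n x
  have h : spinCasimir n = ((n : ℂ) / 2 * ((n : ℂ) / 2 + 1)) • 1 := spinCasimir_eq_holds n
  rw [sum_siteSpin_mul_siteSpin_eq_onSite_spinCasimir, h, onSite_smul', onSite_one']

/-- **Discharge of `commute_heisenbergRing_totalSpin`** (`SU(2)` invariance of the periodic
Heisenberg ring, hubbard.S21): `[Σ_{i ∈ ℤ/Lℤ} 𝐒_i · 𝐒_{i+1}, S^α_tot] = 0` for every `L ≥ 1`,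
spin `n/2` and component `α`. Tasaki (2020) §2.5, eq. (2.5.2).
[cite: Tasaki2020, §2.5 eq. (2.5.2)] -/
theorem commute_heisenbergRing_totalSpin_holds : commute_heisenbergRing_totalSpin := by
  intro L _ n α
  unfold heisenbergRing
  exact Commute.sum_left _ _ _ fun i _ => commute_spinDot_totalSpin n i (i + 1) α

end QLattice

end Literature.MathematicalPhysics.QuantumLattice
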